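import Summits.QuantumFields.YangMills.Theorems.BalabanUVNodesN07QprOfRecordOntoAtRecord
import HarnessLib

/-!
# `Q^{pr}_k(U₀)` ONTO AT A GUARDED BACKGROUND — the generic-`U₀` twin of ✓`QprOfRecord_one_surjective_of_intertwines`: the framed `hQ` of the closed
# GL pin REDUCED BY NAME to the un-framed onto row «`qCplxOp k U₀` onto» ([Balaban1985Averaging] Sect. E), plus the block mean `Q′_k(U₀)` onto at EVERY background

Cell `pub-ymgap` ∕ node-O cover, porter lineage `ymgap-nodeO-port-PTB-1` (g11).  `--kind proof --supports stmt-QuantumFields-27238 --as helper`; count-neutral.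
[B9] = [Balaban1985BackgroundPropagators]; [15] = [Balaban1985Variational]; [B7] = [Balaban1985Averaging].

WHY.  The closed SL∕GL pins of [15] Prop. 4 at the record (✓`…KLCPrAtHierFrameParam` §2∕§3) display the admissibility binder
`hQ : Function.Surjective (QprOfRecord F N k U₀ (hierFrame{,GL}DatumOfRecord F N k U₀))` of def-Y's framed triple; at the FLAT background it is discharged
(✓`QprOfRecord_one_surjective_rec` = «`qCplxOp k 1` onto + (3.114) + `Q′_k(1)` onto»).  At a GENERIC background under the record's guard `SmallBelow … k U₀` two of the
three inputs are generic already: (3.114) for the completed frame (✓`frameIntertwinesTok_hierFrameGL F N K k U₀ hU₀`) and — this file, §1 — the block mean `Q′_k(U₀)` is onto at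
EVERY background (unitary centre transporters).  The lift algebra of §4 of ✓`…N07QprOfRecordOnto` is `U₀`-generic verbatim once `Ū₀ = iterM k ↑U₀ = ↑Ū^k(U₀)` under the guard
(✓`coeField_iter_eq_iterM`).  What REMAINS displayed is exactly the UN-FRAMED row «`qCplxOp k U₀` onto» (= «every skew level-`k` field is `qSkewOp k U₀` of a skew fine field»,
✓`cplxOp_surjective_of_skew`) — [B7] Sect. E's submersion property of `U ↦ Ū^k(U)` at a guarded background, NOT proved here.

WHAT IS PROVED (sorry-free; no definition; standard axioms).
* §1 (generic torus `P`, any `N ≥ 1`) ★ `siteAvgStep_surjective` — the one-step block mean `Q′(U)` of (3.18) is ONTO at EVERY background `U` (`j + 1 ≤ m + K`): the preimage of `μ` is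
  `x ↦ R⋆μ(y)R` on `B(y)` with `R = U(Γ_{y,x})` unitary; ★ `siteAvgIter_surjective` — the `k`-step block mean `Q′_k(U₀)` of (3.19) is onto for every averaging family and every `U₀` (`k ≤ m + K`).
* §2 (the record) ★★ `QprOfRecord_surjective_of_intertwines` — for EVERY datum `𝔥` at a guarded `U₀`: `Surjective (qCplxOp k U₀) → FrameIntertwinesTok F N k U₀ 𝔥 → Surjective (QprOfRecord F N k U₀ 𝔥)`
  («`q^{ff}` onto + finite-rank frame correction via the covariant coarse lift»); ★★ `QprOfRecord_surjective_of_skew_of_intertwines` (the same from the real-form criterion).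
* §3 ★★★ `QprOfRecord_surjective_hierFrameGL_of_qCplxOp` ∕ `…_of_skew` — at def-Y's completed frame of record `hierFrameGLDatumOfRecord F N k U₀` under the guard:
  `Surjective (qCplxOp k U₀) → Surjective (QprOfRecord F N k U₀ (hierFrameGLDatumOfRecord F N k U₀))` — the GL pin's framed `hQ` costs EXACTLY the un-framed `hQ`; the flat row
  ✓`QprOfRecord_one_surjective_rec` is its specialisation (`example`).

HONEST SCOPE.  Linear algebra and unitarity over landed letters; the un-framed onto row at a guarded `U₀ ≠ 1` stays DISPLAYED (n07's road: [B7] Sect. E); the SL datum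
`hierFrameDatumOfRecord` is NOT covered (it does not carry the all-matrix (3.114) token — def-Y TRACE FLAG; only ✓`frameIntertwinesTokSL_hierFrame_one`); `hpos` untouched; nothing of
Bałaban's estimates; K0ᴬ ⟨27238⟩ NOT closed; N07 NOT discharged; COUNT∕K unmoved; finite torus, fixed `ε` — nothing continuum ∕ OS ∕ Clay.  **The Yang–Mills mass gap is NOT
proved by any of this.**  No `sorry`, no `def`, no `instance ∕ notation`.
-/

set_option autoImplicit false

noncomputable section

open scoped BigOperators Matrix Matrix.Norms.L2Operator

namespace Summit.QuantumFields.YangMills.Theorems.N07QprOfRecordOntoGuarded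

open Literature.MathematicalPhysics.QuantumFieldTheory.Balaban1983to89
open Literature.MathematicalPhysics.QuantumFieldTheory.Balaban1983to89.T4Continuum (T4Family)
open Literature.MathematicalPhysics.QuantumFieldTheory.Balaban1983to89.Node00
open BlockAveraging
open Summit.QuantumFields.YangMills.Theorems.N07QOfRecordFlatOnto (cplxOp_surjective_of_skew qCplxOp_one_surjective)
open Summit.QuantumFields.YangMills.Theorems.N07QprOfRecordOnto (QprOfRecord_surjective_of_qPrCplxOp)
open Summit.QuantumFields.YangMills.Theorems.N07QprOfRecordOntoAtRecord (frameIntertwinesTok_hierFrameGL)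

/-! ## §1  The block means `Q′(U)`, `Q′_k(U₀)` are onto at EVERY background -/

section Lattice

variable {P : Params} {N : ℕ} [NeZero N]

/-- ★ **THE ONE-STEP BLOCK MEAN `Q′(U)` OF (3.18) IS ONTO AT EVERY BACKGROUND** (`j + 1 ≤ m + K`): for a coarse site field `μ` the fine field
`x ↦ U(Γ_{y,x})⋆·μ(y)·U(Γ_{y,x})` (`y = blockOf x`, `x = x_r ∈ B(y)`) has block mean `μ` — every one of the `L^d` block sites contributes `L^{-d}·R R⋆ μ(y) R R⋆ = L^{-d}μ(y)`,
the centre transporters `R = U(Γ_{y,x_r}) ∈ SU(N)` being unitary. [cite: Balaban1985BackgroundPropagators, (3.18)–(3.19) p.393; Balaban1985Averaging, (42)–(43) pp.23–24] -/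
theorem siteAvgStep_surjective {j : ℕ} (hj : j + 1 ≤ P.m + P.K) (U : GaugeField P j (SU N)) :
    Function.Surjective (siteAvgStep U) := by
  intro μ
  -- the in-block offset of a fine site, read through `Site.blockEquiv` at a propositionally known block
  have hρ : ∀ (x : Site P j) (y : Site P (j + 1)) (h : blockOf x = y),
      Site.blockEquiv hj (blockOf x) ⟨x, rfl⟩ = Site.blockEquiv hj y ⟨x, h⟩ := by
    intro x y h
    subst h
    rfl
  have hρ' : ∀ (y : Site P (j + 1)) (r : Fin P.d → Fin P.L),
      Site.blockEquiv hj (blockOf (Site.blockSite y r)) ⟨Site.blockSite y r, rfl⟩ = r := by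
    intro y r
    rw [hρ _ y (Site.blockOf_blockSite hj y r)]
    exact (Site.blockEquiv hj y).apply_symm_apply r
  refine ⟨fun x =>
      star ((ctrHol U (blockOf x) (Site.blockEquiv hj (blockOf x) ⟨x, rfl⟩) : SU N) : Matrix (Fin N) (Fin N) ℂ) * μ (blockOf x) *
        ((ctrHol U (blockOf x) (Site.blockEquiv hj (blockOf x) ⟨x, rfl⟩) : SU N) : Matrix (Fin N) (Fin N) ℂ), ?_⟩
  funext y
  rw [siteAvgStep_apply]
  have hterm : ∀ r : Fin P.d → Fin P.L,
      ((ctrHol U y r : SU N) : Matrix (Fin N) (Fin N) ℂ) *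
          (star ((ctrHol U (blockOf (Site.blockSite y r)) (Site.blockEquiv hj (blockOf (Site.blockSite y r)) ⟨Site.blockSite y r, rfl⟩) : SU N) :
                Matrix (Fin N) (Fin N) ℂ) * μ (blockOf (Site.blockSite y r)) *
            ((ctrHol U (blockOf (Site.blockSite y r)) (Site.blockEquiv hj (blockOf (Site.blockSite y r)) ⟨Site.blockSite y r, rfl⟩) : SU N) :
              Matrix (Fin N) (Fin N) ℂ)) *
        star ((ctrHol U y r : SU N) : Matrix (Fin N) (Fin N) ℂ) = μ y := by
    intro r
    rw [hρ' y r, Site.blockOf_blockSite hj y r]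
    simp only [Matrix.mul_assoc]
    rw [coe_mul_star_coe_SU, Matrix.mul_one, ← Matrix.mul_assoc, coe_mul_star_coe_SU, Matrix.one_mul]
  simp_rw [hterm, Finset.sum_const, Finset.card_univ, Fintype.card_fun, Fintype.card_fin]
  rw [← Nat.cast_smul_eq_nsmul ℂ, smul_smul, Nat.cast_pow, mul_inv_cancel₀ (pow_ne_zero _ (Nat.cast_ne_zero.mpr P.L_pos.ne')), one_smul]

/-- ★ **THE `k`-STEP BLOCK MEAN `Q′_k(U₀)` OF (3.19) IS ONTO AT EVERY BACKGROUND, FOR EVERY AVERAGING FAMILY** (`k ≤ m + K`): induction on `Q′_{j+1}(U₀) = Q′(Ū^j(U₀)) ∘ Q′_j(U₀)`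
with §1's one-step ontoness at the background `Ū^j(U₀)`. [cite: Balaban1985BackgroundPropagators, (3.19) p.393; Balaban1985Averaging, (43) p.24] -/
theorem siteAvgIter_surjective (av : ∀ j, Averaging P j (SU N)) (U₀ : GaugeField P 0 (SU N)) :
    ∀ (k : ℕ), k ≤ P.m + P.K → Function.Surjective (siteAvgIter av U₀ k)
  | 0, _ => fun μ => ⟨μ, rfl⟩
  | k + 1, hk => fun μ => by
      obtain ⟨ν, hν⟩ := siteAvgStep_surjective hk (Averaging.iter av k U₀) μ
      obtain ⟨lam, hlam⟩ := siteAvgIter_surjective av U₀ k (Nat.le_of_succ_le hk) ν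
      refine ⟨lam, ?_⟩
      rw [siteAvgIter_succ, LinearMap.comp_apply, hlam, hν]

end Lattice

/-! ## §2  At the record: `Q^{pr}_k(U₀) 𝔥` is onto for every intertwining datum at a guarded background, modulo the un-framed onto row -/

section Record

variable (F : T4Family) (N : ℕ) [NeZero N] (K k : ℕ) (U₀ : GaugeField (F.P K) 0 (SU N))

/-- ★★ **THE GENERIC-BACKGROUND ONTO ROW, MODULO THE UN-FRAMED ONE AND (3.114)**: at a background `U₀` on the record's guard below `k`, for EVERY frame datum `𝔥` that intertwines
(def-Y's token `FrameIntertwinesTok` — (3.114)), if the un-framed linearised averaging `qCplxOp k U₀` is onto then so is `QprOfRecord F N k U₀ 𝔥` (`k ≤ m + K`).  Proof = §4 of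
✓`…N07QprOfRecordOnto` at a general background: given `Z`, take `q^{ff}A = Z`; the defect `Q^{pr}A − Z = −L^{-k}∂_{Ū₀}(Dh(A·U₀))` is a COVARIANT coarse gradient along
`Ū₀ = iterM k ↑U₀ = ↑Ū^k(U₀)` (✓`coeField_iter_eq_iterM` under the guard); lift `μ := Dh(A·U₀)` to a fine site field `λ` with `Q′_k(U₀)λ = μ` (§1 `siteAvgIter_surjective`) and add the pure
gauge direction `D_{U₀}λ`: by (3.114) `Q^{pr}(D_{U₀}λ) = L^{-k}∂_{Ū^k(U₀)}(Q′_k(U₀)λ) = L^{-k}∂_{Ū₀}μ`, so `Q^{pr}(A + D_{U₀}λ) = Z`.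
[cite: Balaban1985BackgroundPropagators, (3.113)–(3.115) p.418, (3.13)–(3.19) p.393; Balaban1985Variational, (45) p.285, (103) p.293; Balaban1985Averaging, (92) p.31] -/
theorem QprOfRecord_surjective_of_intertwines (𝔥 : FrameDatum (F.P K) N k U₀) (hk : k ≤ (F.P K).m + (F.P K).K)
    (hU₀ : SmallBelow (avOfRecord F N K) k U₀) (hq : Function.Surjective (qCplxOp k U₀)) (hV2 : FrameIntertwinesTok F N k U₀ 𝔥) :
    Function.Surjective (QprOfRecord F N k U₀ 𝔥) := by
  refine QprOfRecord_surjective_of_qPrCplxOp F N K k U₀ 𝔥 fun Z => ?_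
  obtain ⟨A, hA⟩ := hq Z
  obtain ⟨lam, hlam⟩ := siteAvgIter_surjective (avOfRecord F N K) U₀ k hk (𝔥.deriv (leftVelC U₀ A))
  refine ⟨A + fun b : PBond (F.P K) 0 => (U₀ b : Matrix (Fin N) (Fin N) ℂ) * lam b.tgt * star (U₀ b : Matrix (Fin N) (Fin N) ℂ) - lam b.src, ?_⟩
  funext c
  have hW : iterM k (coeField U₀) c = ((Averaging.iter (avOfRecord F N K) k U₀ c : SU N) : Matrix (Fin N) (Fin N) ℂ) := by
    rw [← coeField_iter_eq_iterM k hU₀]; rfl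
  rw [map_add, Pi.add_apply, hV2 lam c, hlam, qPrCplxOp_apply, Pi.sub_apply, hA, frameCorr_apply, hW]
  exact sub_add_cancel (Z c) _

/-- ★★ **THE SAME FROM THE REAL-FORM CRITERION**: if every skew-Hermitian level-`k` field is `qSkewOp k U₀` of a skew-Hermitian fine field (✓`cplxOp_surjective_of_skew`'s displayed
target — [Balaban1985Averaging] Sect. E at the guarded background), then `QprOfRecord F N k U₀ 𝔥` is onto for every intertwining datum.
[cite: Balaban1985BackgroundPropagators, (3.13)–(3.16) p.393, (3.113)–(3.115) p.418; Balaban1985Variational, (44)–(45) p.285; Balaban1985Averaging, (124)–(125) p.36] -/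
theorem QprOfRecord_surjective_of_skew_of_intertwines (𝔥 : FrameDatum (F.P K) N k U₀) (hk : k ≤ (F.P K).m + (F.P K).K)
    (hU₀ : SmallBelow (avOfRecord F N K) k U₀)
    (hskew : ∀ Z : PBond (F.P K) k → Matrix (Fin N) (Fin N) ℂ, (∀ c, (Z c)ᴴ = -Z c) →
      ∃ Y : PBond (F.P K) 0 → Matrix (Fin N) (Fin N) ℂ, (∀ b, (Y b)ᴴ = -Y b) ∧ qSkewOp k U₀ Y = Z)
    (hV2 : FrameIntertwinesTok F N k U₀ 𝔥) :
    Function.Surjective (QprOfRecord F N k U₀ 𝔥) := by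
  refine QprOfRecord_surjective_of_intertwines F N K k U₀ 𝔥 hk hU₀ ?_ hV2
  show Function.Surjective (cplxOp (qSkewOp k U₀))
  exact cplxOp_surjective_of_skew (qSkewOp k U₀) hskew

/-! ## §3  At def-Y's completed hierarchical frame of record: the GL pin's framed `hQ` costs exactly the un-framed `hQ` -/

/-- ★★★ **THE GL PIN'S `hQ` REDUCED BY NAME TO THE UN-FRAMED ONTO ROW**: at a background on the record's guard below `k` (`k ≤ m + K`),
`Function.Surjective (qCplxOp k U₀) → Function.Surjective (QprOfRecord F N k U₀ (hierFrameGLDatumOfRecord F N k U₀))` — §2 at the completed frame of record, which CARRIES the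
all-matrix (3.114) token (✓`frameIntertwinesTok_hierFrameGL`).  The binder `hQ` of ✓`prop4UniformPrAtRecord_node00_of_prop5Clause_hierFrameGLRec` is thus the un-framed `hQ` of
[Balaban1985Averaging] Sect. E and nothing more. [cite: Balaban1985BackgroundPropagators, (3.113)–(3.115) p.418, (3.13)–(3.19) p.393; Balaban1985Variational, (45) p.285, (103) p.293; Balaban1985Averaging, (84)–(92) pp.30–31] -/
theorem QprOfRecord_surjective_hierFrameGL_of_qCplxOp (hk : k ≤ (F.P K).m + (F.P K).K) (hU₀ : SmallBelow (avOfRecord F N K) k U₀)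
    (hq : Function.Surjective (qCplxOp k U₀)) :
    Function.Surjective (QprOfRecord F N k U₀ (hierFrameGLDatumOfRecord F N k U₀)) :=
  QprOfRecord_surjective_of_intertwines F N K k U₀ (hierFrameGLDatumOfRecord F N k U₀) hk hU₀ hq (frameIntertwinesTok_hierFrameGL F N K k U₀ hU₀)

/-- ★★★ **THE GL PIN'S `hQ` FROM THE REAL-FORM CRITERION** at a guarded background: «every skew level-`k` field is `qSkewOp k U₀` of a skew fine field» ⟹
`QprOfRecord F N k U₀ (hierFrameGLDatumOfRecord F N k U₀)` onto (`k ≤ m + K`). [cite: Balaban1985BackgroundPropagators, (3.13)–(3.16) p.393, (3.113)–(3.115) p.418; Balaban1985Variational, (44)–(45) p.285; Balaban1985Averaging, (84)–(92) pp.30–31, (124)–(125) p.36] -/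
theorem QprOfRecord_surjective_hierFrameGL_of_skew (hk : k ≤ (F.P K).m + (F.P K).K) (hU₀ : SmallBelow (avOfRecord F N K) k U₀)
    (hskew : ∀ Z : PBond (F.P K) k → Matrix (Fin N) (Fin N) ℂ, (∀ c, (Z c)ᴴ = -Z c) →
      ∃ Y : PBond (F.P K) 0 → Matrix (Fin N) (Fin N) ℂ, (∀ b, (Y b)ᴴ = -Y b) ∧ qSkewOp k U₀ Y = Z) :
    Function.Surjective (QprOfRecord F N k U₀ (hierFrameGLDatumOfRecord F N k U₀)) :=
  QprOfRecord_surjective_of_skew_of_intertwines F N K k U₀ (hierFrameGLDatumOfRecord F N k U₀) hk hU₀ hskew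
    (frameIntertwinesTok_hierFrameGL F N K k U₀ hU₀)

/-- Specialisation check (vacuity guard of the edition): at `U₀ = 1` §3 with ✓`qCplxOp_one_surjective` and ✓`smallBelow_avOfRecord_one` IS the landed flat row
✓`QprOfRecord_one_surjective_rec` — the generic theorem says nothing new there. [cite: Balaban1985Variational, (45) p.285 (bookkeeping)] -/
example (hk : k ≤ (F.P K).m + (F.P K).K) :
    Function.Surjective (QprOfRecord F N k (1 : GaugeField (F.P K) 0 (SU N)) (hierFrameGLDatumOfRecord F N k (1 : GaugeField (F.P K) 0 (SU N)))) :=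
  QprOfRecord_surjective_hierFrameGL_of_qCplxOp F N K k (1 : GaugeField (F.P K) 0 (SU N)) hk (smallBelow_avOfRecord_one F N k)
    (qCplxOp_one_surjective (P := F.P K) (N := N) hk)

end Record

end Summit.QuantumFields.YangMills.Theorems.N07QprOfRecordOntoGuarded

end
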